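import Mathlib
import HarnessLib
import Summits.Ventures.LatticeQCDFlow.Scoring.SplitChainDependsOn
import Summits.Ventures.LatticeQCDFlow.Scoring.MinorisedGreenKubo
import Summits.Ventures.LatticeQCDFlow.Scoring.ChainMeanSquareError
import Summits.Ventures.LatticeQCDFlow.Scoring.SplitChainFreshPairMoments

/-!
# Decorrelation of the past from a future block under a minorisation, from any start:
# `|E[G · g(X_{u+w})] − E[G] E[g(X_{u+w})]| ≤ 2 C_g (1−e)^w E|G|` and the squared-block-sum form
# `|E[G · S²] − E[G] E[S²]| ≤ 4 C_{f̄}² (1+ρ)/(1−ρ)² · ρ^{gap} · E|G|`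

HONEST FRAMING: exact (Metropolis-corrected) sampling algorithms for lattice gauge theory;
figures of merit are autocorrelation/cost numbers at stated couplings and volumes; no
continuum-physics claim.

Venture `LatticeQCDFlow` (cell pub-lqcd), topic `Scoring`; FANOUT row 8 (`s0-cpn-nemc`, GEN-19).
NEW WORK of the cell, not a published result; no definition is introduced.  Setting: `κ` a Markov
kernel minorised by a probability law `ν`, `κ(x, ·) ≥ ε ν` with `ε < 1` (`ρ = 1 − e`, `e = ε.toReal`),
`P_{μ₀}` the chain's path law from ANY initial law; `G` a bounded measurable functional of the path
that depends only on the coordinates up to time `u` (`DependsOn G (Set.Iic u)`).  Two tree inputs: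
the `t`-step tower property in `DependsOn` form (`Scoring/SplitChainDependsOn.chain_tower_iterate_dependsOn`:
`E[G · g(X_{u+w})] = E[G · ((kop κ)^[w] g)(X_u)]`) and the structure of the iterated kernel
(`Scoring/MinorisedGreenKubo.iterate_kop_eq_const_add_residual`: `(kop κ)^[w] g = c + ρ^w (kop R)^[w] g`
with a CONSTANT `c`).  The constant cancels in the covariance, so
`E[G · g(X_{u+w})] − E[G] E[g(X_{u+w})] = ρ^w (E[G · R^w g(X_u)] − E[G] E[R^w g(X_u)])`, of size at most
`2 C_g ρ^w E|G|`: the past and a single future observation decorrelate at the geometric rate with NO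
stationarity and no reversibility.  Peeling the later of two future times by the tower property
first (`E[G · g₁(X_v) g₂(X_{v+m})] = E[G · (g₁ · (kop κ)^[m] g₂)(X_v)]`) gives the two-time form with the
sup-norm of `(kop κ)^[m] g₂` in place of `C_{g₂}` — for a `π`-centred `g₂ = f̄` that sup-norm is
`≤ 2 C_{f̄} ρ^m` (`abs_iterate_kop_centred_le_minorised`) — and summing over the `b²` pairs of a
future block with `Σ_{l,l'<b} ρ^{max(l,l')} ≤ (1+ρ)/(1−ρ)²` (`Scoring/ChainMeanSquareError.sum_sum_max`,
`sum_range_odd_mul_pow_le`) the squared block sum `S² = (Σ_{l<b} f̄(X_{u+g+l}))²` decorrelates from the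
past at rate `ρ^g`, UNIFORMLY IN THE BLOCK LENGTH `b`.  With `G` = the square of an earlier block sum
this is the covariance input of the consistency of batch means (`Scoring/BatchMeansConsistency.lean`).
Printed counterpart NAMED ONLY, nothing cited as a fact: φ-mixing of uniformly ergodic (Doeblin)
chains (Ibragimov 1962; Bradley 2005 survey §3).

## Content (`κ(x, ·) ≥ ε ν`, `ε < 1`, `ρ = 1 − e`; `P_{μ₀}` from any `μ₀`; `DependsOn G (Set.Iic u)`,
## `|G| ≤ C_G` measurable)

* **`chain_dependsOn_future_decorrelation`** — `|E[G g(X_{u+w})] − E[G] E[g(X_{u+w})]| ≤ 2 C_g ρ^w ∫|G|`;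
* **`chain_dependsOn_futurePair_decorrelation`** — with `|(kop κ)^[m] g₂| ≤ B`:
  `|E[G g₁(X_{u+w}) g₂(X_{u+w+m})] − E[G] E[g₁(X_{u+w}) g₂(X_{u+w+m})]| ≤ 2 C_{g₁} B ρ^w ∫|G|`;
* **`chain_dependsOn_blockSq_decorrelation`** — for `π` invariant and `|f| ≤ C`, with
  `S = Σ_{l<b} (f(X_{u+g+l}) − π f)`:
  `|E[G S²] − E[G] E[S²]| ≤ 4 (2C)² ((1+ρ)/(1−ρ)²) ρ^g ∫|G| dP_{μ₀}`, every `μ₀`, `u`, `g`, `b`.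

NOT CLAIMED: total-variation / φ-mixing statements as such; anything about a concrete sampler.
-/

noncomputable section

namespace Summit.Ventures.LatticeQCDFlow.Scoring

open MeasureTheory ProbabilityTheory Filter Finset Preorder Literature.Probability.MarkovChains
open scoped ENNReal Topology

variable {Ω : Type*} [MeasurableSpace Ω]

section Decorrelation

variable {κ : Kernel Ω Ω} [IsMarkovKernel κ] {ν : Measure Ω} [IsProbabilityMeasure ν] {ε : ℝ≥0∞}
  (μ₀ : Measure Ω) [IsProbabilityMeasure μ₀]

/-- **THE PAST AND ONE FUTURE OBSERVATION DECORRELATE GEOMETRICALLY, FROM ANY START.**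
`κ(x, ·) ≥ ε ν` (`ε < 1`), `G` bounded measurable with `DependsOn G (Set.Iic u)`, `|g| ≤ C_g`
measurable: `|E[G · g(X_{u+w})] − E[G] · E[g(X_{u+w})]| ≤ 2 C_g (1 − e)^w ∫ |G| dP_{μ₀}`. -/
theorem chain_dependsOn_future_decorrelation
    (hmin : ∀ x {B : Set Ω}, MeasurableSet B → ε * ν B ≤ κ x B) (hε : ε < 1) (u w : ℕ)
    {G : (ℕ → Ω) → ℝ}
    (hG : Measurable G) (hGd : DependsOn G (Set.Iic u)) {CG : ℝ} (hCG : ∀ x, |G x| ≤ CG)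
    {g : Ω → ℝ} (hg : Measurable g) {Cg : ℝ} (hCg : ∀ x, |g x| ≤ Cg) :
    |∫ x, G x * g (x (u + w)) ∂(Kernel.trajMeasure (X := fun _ : ℕ => Ω) μ₀
        (fun n : ℕ => κ.comap (fun h : (i : ↥(Finset.Iic n)) → Ω => h ⟨n, Finset.mem_Iic.2 le_rfl⟩)
          (measurable_pi_apply _)))
      - (∫ x, G x ∂(Kernel.trajMeasure (X := fun _ : ℕ => Ω) μ₀
        (fun n : ℕ => κ.comap (fun h : (i : ↥(Finset.Iic n)) → Ω => h ⟨n, Finset.mem_Iic.2 le_rfl⟩)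
          (measurable_pi_apply _))))
        * ∫ x, g (x (u + w)) ∂(Kernel.trajMeasure (X := fun _ : ℕ => Ω) μ₀
        (fun n : ℕ => κ.comap (fun h : (i : ↥(Finset.Iic n)) → Ω => h ⟨n, Finset.mem_Iic.2 le_rfl⟩)
          (measurable_pi_apply _)))|
      ≤ 2 * Cg * (1 - ε.toReal) ^ w * ∫ x, |G x| ∂(Kernel.trajMeasure (X := fun _ : ℕ => Ω) μ₀
        (fun n : ℕ => κ.comap (fun h : (i : ↥(Finset.Iic n)) → Ω => h ⟨n, Finset.mem_Iic.2 le_rfl⟩)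
          (measurable_pi_apply _))) := by
  set P := Kernel.trajMeasure (X := fun _ : ℕ => Ω) μ₀
      (fun n : ℕ => κ.comap (fun h : (i : ↥(Finset.Iic n)) → Ω => h ⟨n, Finset.mem_Iic.2 le_rfl⟩)
        (measurable_pi_apply _)) with hP
  haveI := Doeblin.isMarkovKernel_residualKernel (κ := κ) (ν := ν) (hmin := hmin) hε
  obtain ⟨-, hl0, -⟩ := one_sub_toReal_eq_of_lt_one (ε := ε) hε
  set R := Doeblin.residualKernel κ ν ε hmin with hR
  obtain ⟨c, hc⟩ := iterate_kop_eq_const_add_residual (κ := κ) (ν := ν) (hmin := hmin) hε hg hCg w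
  obtain ⟨hRm, hRb⟩ := iterate_kop_bounded_measurable R hg hCg w
  have hCG0 : 0 ≤ CG := (abs_nonneg _).trans (hCG (Classical.choice
    (nonempty_of_isProbabilityMeasure P)))
  have hCg0 : 0 ≤ Cg := (abs_nonneg _).trans (hCg (Classical.choice
    (nonempty_of_isProbabilityMeasure μ₀)))
  -- tower: `E[G g(X_{u+w})] = E[G (K^w g)(X_u)]`, and the same with `G = 1`
  have h1 := chain_tower_iterate_dependsOn κ μ₀ u w hG hGd hCG hg hCg
  rw [← hP] at h1
  have h2 := chain_tower_iterate_dependsOn κ μ₀ u w (G := fun _ => (1 : ℝ)) measurable_const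
    ((dependsOn_const (1 : ℝ)).mono (Set.empty_subset _)) (CG := 1) (fun _ => by simp) hg hCg
  rw [← hP] at h2
  simp only [one_mul] at h2
  -- insert the structure `K^w g = c + ρ^w R^w g`
  have hKw : ∀ y, (kop κ)^[w] g y = c + (1 - ε.toReal) ^ w * (kop R)^[w] g y := fun y => by
    rw [hc]
  have hiG : Integrable G P := integrable_of_bounded P hG hCG
  have hiGR : Integrable (fun x : ℕ → Ω => G x * (kop R)^[w] g (x u)) P :=
    integrable_of_bounded P (hG.mul (hRm.comp (measurable_pi_apply _))) (C := CG * Cg) fun x => by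
      rw [abs_mul]; exact mul_le_mul (hCG x) (hRb _) (abs_nonneg _) hCG0
  have hiR : Integrable (fun x : ℕ → Ω => (kop R)^[w] g (x u)) P :=
    integrable_of_bounded P (hRm.comp (measurable_pi_apply _)) fun x => hRb _
  have hA : ∫ x, G x * g (x (u + w)) ∂P
      = c * ∫ x, G x ∂P + (1 - ε.toReal) ^ w * ∫ x, G x * (kop R)^[w] g (x u) ∂P := by
    rw [h1]
    have hpt : ∀ x : ℕ → Ω, G x * (kop κ)^[w] g (x u)
        = c * G x + (1 - ε.toReal) ^ w * (G x * (kop R)^[w] g (x u)) := fun x => by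
      rw [hKw]; ring
    rw [integral_congr_ae (ae_of_all _ hpt), integral_add (hiG.const_mul c) (hiGR.const_mul _),
      integral_const_mul, integral_const_mul]
  have hB : ∫ x, g (x (u + w)) ∂P = c + (1 - ε.toReal) ^ w * ∫ x, (kop R)^[w] g (x u) ∂P := by
    rw [h2]
    have hpt : ∀ x : ℕ → Ω, (kop κ)^[w] g (x u)
        = c + (1 - ε.toReal) ^ w * (kop R)^[w] g (x u) := fun x => hKw _
    rw [integral_congr_ae (ae_of_all _ hpt), integral_add (integrable_const c) (hiR.const_mul _),
      integral_const, probReal_univ, one_smul, integral_const_mul]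
  have hdiff : ∫ x, G x * g (x (u + w)) ∂P - (∫ x, G x ∂P) * ∫ x, g (x (u + w)) ∂P
      = (1 - ε.toReal) ^ w * (∫ x, G x * (kop R)^[w] g (x u) ∂P
        - (∫ x, G x ∂P) * ∫ x, (kop R)^[w] g (x u) ∂P) := by
    rw [hA, hB]; ring
  rw [hdiff, abs_mul, abs_of_nonneg (pow_nonneg hl0 w)]
  -- the three elementary bounds
  have hb1 : |∫ x, G x * (kop R)^[w] g (x u) ∂P| ≤ Cg * ∫ x, |G x| ∂P := by
    calc |∫ x, G x * (kop R)^[w] g (x u) ∂P| ≤ ∫ x, |G x * (kop R)^[w] g (x u)| ∂P :=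
          abs_integral_le_integral_abs
      _ ≤ ∫ x, Cg * |G x| ∂P := by
          refine integral_mono_of_nonneg (ae_of_all _ fun x => abs_nonneg _) (hiG.abs.const_mul Cg)
            (ae_of_all _ fun x => ?_)
          show |G x * (kop R)^[w] g (x u)| ≤ Cg * |G x|
          rw [abs_mul, mul_comm]
          exact mul_le_mul_of_nonneg_right (hRb _) (abs_nonneg _)
      _ = Cg * ∫ x, |G x| ∂P := integral_const_mul _ _
  have hb2 : |∫ x, G x ∂P| ≤ ∫ x, |G x| ∂P := abs_integral_le_integral_abs
  have hb3 : |∫ x, (kop R)^[w] g (x u) ∂P| ≤ Cg := by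
    calc |∫ x, (kop R)^[w] g (x u) ∂P| = ‖∫ x, (kop R)^[w] g (x u) ∂P‖ := (Real.norm_eq_abs _).symm
      _ ≤ Cg * P.real Set.univ := norm_integral_le_of_norm_le_const (Eventually.of_forall fun x => by
          rw [Real.norm_eq_abs]; exact hRb _)
      _ = Cg := by rw [probReal_univ, mul_one]
  have hI0 : 0 ≤ ∫ x, |G x| ∂P := integral_nonneg fun x => abs_nonneg _
  have hprod : |(∫ x, G x ∂P) * ∫ x, (kop R)^[w] g (x u) ∂P| ≤ (∫ x, |G x| ∂P) * Cg := by
    rw [abs_mul]; exact mul_le_mul hb2 hb3 (abs_nonneg _) hI0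
  calc (1 - ε.toReal) ^ w * |∫ x, G x * (kop R)^[w] g (x u) ∂P
        - (∫ x, G x ∂P) * ∫ x, (kop R)^[w] g (x u) ∂P|
      ≤ (1 - ε.toReal) ^ w * (Cg * ∫ x, |G x| ∂P + (∫ x, |G x| ∂P) * Cg) :=
        mul_le_mul_of_nonneg_left ((abs_sub _ _).trans (add_le_add hb1 hprod)) (pow_nonneg hl0 w)
    _ = 2 * Cg * (1 - ε.toReal) ^ w * ∫ x, |G x| ∂P := by ring

/-- **Two future times**: with `|(kop κ)^[m] g₂| ≤ B` (for a `π`-centred `g₂` one may take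
`B = 2 C_{g₂} ρ^m`):
`|E[G · g₁(X_{u+w}) g₂(X_{u+w+m})] − E[G] · E[g₁(X_{u+w}) g₂(X_{u+w+m})]| ≤ 2 C_{g₁} B (1 − e)^w ∫ |G|`. -/
theorem chain_dependsOn_futurePair_decorrelation
    (hmin : ∀ x {B : Set Ω}, MeasurableSet B → ε * ν B ≤ κ x B) (hε : ε < 1) (u w m : ℕ)
    {G : (ℕ → Ω) → ℝ}
    (hG : Measurable G) (hGd : DependsOn G (Set.Iic u)) {CG : ℝ} (hCG : ∀ x, |G x| ≤ CG)
    {g₁ g₂ : Ω → ℝ} (hg₁ : Measurable g₁) {Cg₁ : ℝ} (hCg₁ : ∀ x, |g₁ x| ≤ Cg₁)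
    (hg₂ : Measurable g₂) {Cg₂ : ℝ} (hCg₂ : ∀ x, |g₂ x| ≤ Cg₂) {B : ℝ}
    (hB : ∀ y, |(kop κ)^[m] g₂ y| ≤ B) :
    |∫ x, G x * (g₁ (x (u + w)) * g₂ (x (u + w + m))) ∂(Kernel.trajMeasure (X := fun _ : ℕ => Ω) μ₀
        (fun n : ℕ => κ.comap (fun h : (i : ↥(Finset.Iic n)) → Ω => h ⟨n, Finset.mem_Iic.2 le_rfl⟩)
          (measurable_pi_apply _)))
      - (∫ x, G x ∂(Kernel.trajMeasure (X := fun _ : ℕ => Ω) μ₀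
        (fun n : ℕ => κ.comap (fun h : (i : ↥(Finset.Iic n)) → Ω => h ⟨n, Finset.mem_Iic.2 le_rfl⟩)
          (measurable_pi_apply _))))
        * ∫ x, g₁ (x (u + w)) * g₂ (x (u + w + m)) ∂(Kernel.trajMeasure (X := fun _ : ℕ => Ω) μ₀
        (fun n : ℕ => κ.comap (fun h : (i : ↥(Finset.Iic n)) → Ω => h ⟨n, Finset.mem_Iic.2 le_rfl⟩)
          (measurable_pi_apply _)))|
      ≤ 2 * (Cg₁ * B) * (1 - ε.toReal) ^ w * ∫ x, |G x| ∂(Kernel.trajMeasure (X := fun _ : ℕ => Ω) μ₀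
        (fun n : ℕ => κ.comap (fun h : (i : ↥(Finset.Iic n)) → Ω => h ⟨n, Finset.mem_Iic.2 le_rfl⟩)
          (measurable_pi_apply _))) := by
  set P := Kernel.trajMeasure (X := fun _ : ℕ => Ω) μ₀
      (fun n : ℕ => κ.comap (fun h : (i : ↥(Finset.Iic n)) → Ω => h ⟨n, Finset.mem_Iic.2 le_rfl⟩)
        (measurable_pi_apply _)) with hP
  obtain ⟨hKm, -⟩ := iterate_kop_bounded_measurable κ hg₂ hCg₂ m
  have hCG0 : 0 ≤ CG := (abs_nonneg _).trans (hCG (Classical.choice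
    (nonempty_of_isProbabilityMeasure P)))
  have hCg₁0 : 0 ≤ Cg₁ := (abs_nonneg _).trans (hCg₁ (Classical.choice
    (nonempty_of_isProbabilityMeasure μ₀)))
  -- the lag-`m` observable `H = g₁ · K^m g₂`
  have hHm : Measurable fun y => g₁ y * (kop κ)^[m] g₂ y := hg₁.mul hKm
  have hHb : ∀ y, |g₁ y * (kop κ)^[m] g₂ y| ≤ Cg₁ * B := fun y => by
    rw [abs_mul]; exact mul_le_mul (hCg₁ y) (hB y) (abs_nonneg _) hCg₁0
  -- peel the later time: functional `G · g₁(X_{u+w})` depends on `≤ u + w`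
  have hF1m : Measurable fun x : ℕ → Ω => G x * g₁ (x (u + w)) :=
    hG.mul (hg₁.comp (measurable_pi_apply _))
  have hF1d : DependsOn (fun x : ℕ → Ω => G x * g₁ (x (u + w))) (Set.Iic (u + w)) := by
    intro x y hxy
    show G x * g₁ (x (u + w)) = G y * g₁ (y (u + w))
    rw [hGd (fun i hi => hxy i (Set.mem_Iic.2 ((Set.mem_Iic.1 hi).trans (Nat.le_add_right u w)))),
      hxy (u + w) (Set.mem_Iic.2 le_rfl)]
  have hF1b : ∀ x : ℕ → Ω, |G x * g₁ (x (u + w))| ≤ CG * Cg₁ := fun x => by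
    rw [abs_mul]; exact mul_le_mul (hCG x) (hCg₁ _) (abs_nonneg _) hCG0
  have h1 := chain_tower_iterate_dependsOn κ μ₀ (u + w) m hF1m hF1d hF1b hg₂ hCg₂
  rw [← hP] at h1
  have hF2m : Measurable fun x : ℕ → Ω => g₁ (x (u + w)) := hg₁.comp (measurable_pi_apply _)
  have hF2d : DependsOn (fun x : ℕ → Ω => g₁ (x (u + w))) (Set.Iic (u + w)) := by
    intro x y hxy
    show g₁ (x (u + w)) = g₁ (y (u + w))
    rw [hxy (u + w) (Set.mem_Iic.2 le_rfl)]
  have h2 := chain_tower_iterate_dependsOn κ μ₀ (u + w) m hF2m hF2d (fun x => hCg₁ _) hg₂ hCg₂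
  rw [← hP] at h2
  have hL : ∫ x, G x * (g₁ (x (u + w)) * g₂ (x (u + w + m))) ∂P
      = ∫ x, G x * (g₁ (x (u + w)) * (kop κ)^[m] g₂ (x (u + w))) ∂P := by
    have e1 : ∫ x, G x * (g₁ (x (u + w)) * g₂ (x (u + w + m))) ∂P
        = ∫ x, G x * g₁ (x (u + w)) * g₂ (x (u + w + m)) ∂P :=
      integral_congr_ae (ae_of_all _ fun x => by ring)
    rw [e1, h1]
    exact integral_congr_ae (ae_of_all _ fun x => by ring)
  rw [hL, h2]
  exact chain_dependsOn_future_decorrelation μ₀ hmin hε u w hG hGd hCG hHm hHb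

variable {π : Measure Ω} [IsProbabilityMeasure π]

/-- **THE PAST AND A FUTURE SQUARED BLOCK SUM DECORRELATE AT RATE `ρ^{gap}`, UNIFORMLY IN THE
BLOCK LENGTH.**  `π` invariant, `κ(x, ·) ≥ ε ν` (`0 < ε < 1`, `ρ = 1 − e`), `|f| ≤ C` measurable,
`f̄ = f − π f`; `G` bounded measurable with `DependsOn G (Set.Iic u)`; `S = Σ_{l<b} f̄(X_{u+g+l})`.  For
EVERY initial law `μ₀` and all `u, g, b`:
`|E[G · S²] − E[G] · E[S²]| ≤ 4 (2C)² ((1+ρ)/(1−ρ)²) ρ^g ∫ |G| dP_{μ₀}`. -/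
theorem chain_dependsOn_blockSq_decorrelation (hπ : Kernel.Invariant κ π)
    (hmin : ∀ x {B : Set Ω}, MeasurableSet B → ε * ν B ≤ κ x B) (hε0 : 0 < ε) (hε : ε < 1)
    {f : Ω → ℝ} (hf : Measurable f) {C : ℝ} (hC : ∀ x, |f x| ≤ C) (u g b : ℕ)
    {G : (ℕ → Ω) → ℝ} (hG : Measurable G) (hGd : DependsOn G (Set.Iic u)) {CG : ℝ}
    (hCG : ∀ x, |G x| ≤ CG) :
    |∫ x, G x * (∑ l ∈ Finset.range b, (f (x (u + g + l)) - ∫ z, f z ∂π)) ^ 2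
        ∂(Kernel.trajMeasure (X := fun _ : ℕ => Ω) μ₀
          (fun n : ℕ => κ.comap (fun h : (i : ↥(Finset.Iic n)) → Ω => h ⟨n, Finset.mem_Iic.2 le_rfl⟩)
            (measurable_pi_apply _)))
      - (∫ x, G x ∂(Kernel.trajMeasure (X := fun _ : ℕ => Ω) μ₀
          (fun n : ℕ => κ.comap (fun h : (i : ↥(Finset.Iic n)) → Ω => h ⟨n, Finset.mem_Iic.2 le_rfl⟩)
            (measurable_pi_apply _))))
        * ∫ x, (∑ l ∈ Finset.range b, (f (x (u + g + l)) - ∫ z, f z ∂π)) ^ 2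
          ∂(Kernel.trajMeasure (X := fun _ : ℕ => Ω) μ₀
            (fun n : ℕ => κ.comap (fun h : (i : ↥(Finset.Iic n)) → Ω => h ⟨n, Finset.mem_Iic.2 le_rfl⟩)
              (measurable_pi_apply _)))|
      ≤ 4 * (2 * C) ^ 2 * ((1 + (1 - ε.toReal)) / (1 - (1 - ε.toReal)) ^ 2) * (1 - ε.toReal) ^ g
        * ∫ x, |G x| ∂(Kernel.trajMeasure (X := fun _ : ℕ => Ω) μ₀
          (fun n : ℕ => κ.comap (fun h : (i : ↥(Finset.Iic n)) → Ω => h ⟨n, Finset.mem_Iic.2 le_rfl⟩)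
            (measurable_pi_apply _))) := by
  set P := Kernel.trajMeasure (X := fun _ : ℕ => Ω) μ₀
      (fun n : ℕ => κ.comap (fun h : (i : ↥(Finset.Iic n)) → Ω => h ⟨n, Finset.mem_Iic.2 le_rfl⟩)
        (measurable_pi_apply _)) with hP
  obtain ⟨-, hl0, he1⟩ := one_sub_toReal_eq_of_lt_one (ε := ε) hε
  have he0 : 0 < ε.toReal := ENNReal.toReal_pos hε0.ne' (ne_top_of_lt hε)
  have hρ1 : 1 - ε.toReal < 1 := by linarith
  set ρ := 1 - ε.toReal with hρ
  set c := ∫ z, f z ∂π with hc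
  obtain ⟨hfb, hCfb, hfb0⟩ := centred_observable_bounds π hf hC
  have hC0 : 0 ≤ C := (abs_nonneg _).trans (hC (Classical.choice (nonempty_of_isProbabilityMeasure π)))
  have hCG0 : 0 ≤ CG := (abs_nonneg _).trans (hCG (Classical.choice
    (nonempty_of_isProbabilityMeasure P)))
  have hI0 : 0 ≤ ∫ x, |G x| ∂P := integral_nonneg fun x => abs_nonneg _
  -- the summands `a l x = f̄(x_{u+g+l})`
  set a : ℕ → (ℕ → Ω) → ℝ := fun l x => f (x (u + g + l)) - c with ha
  have ham : ∀ l, Measurable (a l) := fun l => hfb.comp (measurable_pi_apply _)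
  have hab : ∀ l x, |a l x| ≤ 2 * C := fun l x => hCfb _
  -- each pair decorrelates: `|E[G a_l a_l'] − E[G] E[a_l a_l']| ≤ 4 (2C)² ρ^g ρ^{max l l'} ∫|G|`
  have hord : ∀ l l', l ≤ l' →
      |∫ x, G x * (a l x * a l' x) ∂P - (∫ x, G x ∂P) * ∫ x, a l x * a l' x ∂P|
        ≤ 4 * (2 * C) ^ 2 * ρ ^ g * ρ ^ (max l l') * ∫ x, |G x| ∂P := by
    intro l l' hll'
    obtain ⟨d, rfl⟩ := Nat.exists_eq_add_of_le hll'
    have hdec : ∀ y, |(kop κ)^[d] (fun z => f z - c) y| ≤ 2 * (2 * C) * ρ ^ d :=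
      fun y => abs_iterate_kop_centred_le_minorised (κ := κ) (ν := ν) hπ hmin hε hfb hCfb hfb0 _ y
    have key := chain_dependsOn_futurePair_decorrelation μ₀ hmin hε u
      (g + l) d hG hGd hCG hfb hCfb hfb hCfb hdec
    rw [← hP] at key
    have e1 : u + (g + l) = u + g + l := by omega
    have e2 : u + g + l + d = u + g + (l + d) := by omega
    rw [e1] at key
    rw [e2, ← hρ] at key
    refine key.trans (le_of_eq ?_)
    rw [max_eq_right hll', pow_add, pow_add]
    ring
  have hpair : ∀ l l',
      |∫ x, G x * (a l x * a l' x) ∂P - (∫ x, G x ∂P) * ∫ x, a l x * a l' x ∂P|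
        ≤ 4 * (2 * C) ^ 2 * ρ ^ g * ρ ^ (max l l') * ∫ x, |G x| ∂P := by
    intro l l'
    rcases le_total l l' with hll' | hl'l
    · exact hord l l' hll'
    · have hsym1 : ∫ x, G x * (a l x * a l' x) ∂P = ∫ x, G x * (a l' x * a l x) ∂P :=
        integral_congr_ae (ae_of_all _ fun x => by ring)
      have hsym2 : ∫ x, a l x * a l' x ∂P = ∫ x, a l' x * a l x ∂P :=
        integral_congr_ae (ae_of_all _ fun x => by ring)
      rw [hsym1, hsym2, max_comm]
      exact hord l' l hl'l
  -- expand the squares into double sums and integrate termwise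
  have hiGaa : ∀ l l', Integrable (fun x => G x * (a l x * a l' x)) P := fun l l' =>
    integrable_of_bounded P (hG.mul ((ham l).mul (ham l'))) (C := CG * (2 * C * (2 * C))) fun x => by
      rw [abs_mul, abs_mul]
      exact mul_le_mul (hCG x) (mul_le_mul (hab l x) (hab l' x) (abs_nonneg _) (by positivity))
        (by positivity) hCG0
  have hiaa : ∀ l l', Integrable (fun x => a l x * a l' x) P := fun l l' =>
    integrable_of_bounded P ((ham l).mul (ham l')) (C := 2 * C * (2 * C)) fun x => by
      rw [abs_mul]; exact mul_le_mul (hab l x) (hab l' x) (abs_nonneg _) (by positivity)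
  have hsqG : ∀ x : ℕ → Ω, G x * (∑ l ∈ Finset.range b, a l x) ^ 2
      = ∑ l ∈ Finset.range b, ∑ l' ∈ Finset.range b, G x * (a l x * a l' x) := fun x => by
    rw [sq, Finset.sum_mul_sum, Finset.mul_sum]
    exact Finset.sum_congr rfl fun l _ => Finset.mul_sum _ _ _
  have hsq : ∀ x : ℕ → Ω, (∑ l ∈ Finset.range b, a l x) ^ 2
      = ∑ l ∈ Finset.range b, ∑ l' ∈ Finset.range b, a l x * a l' x := fun x => by
    rw [sq, Finset.sum_mul_sum]
  have hEG : ∫ x, G x * (∑ l ∈ Finset.range b, a l x) ^ 2 ∂P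
      = ∑ l ∈ Finset.range b, ∑ l' ∈ Finset.range b, ∫ x, G x * (a l x * a l' x) ∂P := by
    rw [integral_congr_ae (ae_of_all _ hsqG), integral_finsetSum _ fun l _ =>
      integrable_finsetSum _ fun l' _ => hiGaa l l']
    exact Finset.sum_congr rfl fun l _ => integral_finsetSum _ fun l' _ => hiGaa l l'
  have hE : ∫ x, (∑ l ∈ Finset.range b, a l x) ^ 2 ∂P
      = ∑ l ∈ Finset.range b, ∑ l' ∈ Finset.range b, ∫ x, a l x * a l' x ∂P := by
    rw [integral_congr_ae (ae_of_all _ hsq), integral_finsetSum _ fun l _ =>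
      integrable_finsetSum _ fun l' _ => hiaa l l']
    exact Finset.sum_congr rfl fun l _ => integral_finsetSum _ fun l' _ => hiaa l l'
  have hgoal : ∫ x, G x * (∑ l ∈ Finset.range b, a l x) ^ 2 ∂P
      - (∫ x, G x ∂P) * ∫ x, (∑ l ∈ Finset.range b, a l x) ^ 2 ∂P
      = ∑ l ∈ Finset.range b, ∑ l' ∈ Finset.range b,
          (∫ x, G x * (a l x * a l' x) ∂P - (∫ x, G x ∂P) * ∫ x, a l x * a l' x ∂P) := by
    rw [hEG, hE, Finset.mul_sum]
    simp_rw [Finset.mul_sum, ← Finset.sum_sub_distrib]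
  show |∫ x, G x * (∑ l ∈ Finset.range b, a l x) ^ 2 ∂P
      - (∫ x, G x ∂P) * ∫ x, (∑ l ∈ Finset.range b, a l x) ^ 2 ∂P|
    ≤ 4 * (2 * C) ^ 2 * ((1 + ρ) / (1 - ρ) ^ 2) * ρ ^ g * ∫ x, |G x| ∂P
  rw [hgoal]
  calc |∑ l ∈ Finset.range b, ∑ l' ∈ Finset.range b,
          (∫ x, G x * (a l x * a l' x) ∂P - (∫ x, G x ∂P) * ∫ x, a l x * a l' x ∂P)|
      ≤ ∑ l ∈ Finset.range b, ∑ l' ∈ Finset.range b,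
          |∫ x, G x * (a l x * a l' x) ∂P - (∫ x, G x ∂P) * ∫ x, a l x * a l' x ∂P| :=
        (Finset.abs_sum_le_sum_abs _ _).trans (Finset.sum_le_sum fun l _ =>
          Finset.abs_sum_le_sum_abs _ _)
    _ ≤ ∑ l ∈ Finset.range b, ∑ l' ∈ Finset.range b,
          (4 * (2 * C) ^ 2 * ρ ^ g * ∫ x, |G x| ∂P) * ρ ^ (max l l') :=
        Finset.sum_le_sum fun l _ => Finset.sum_le_sum fun l' _ =>
          (hpair l l').trans (le_of_eq (by ring))
    _ = ∑ k ∈ Finset.range b, (2 * (k : ℝ) + 1)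
          * ((4 * (2 * C) ^ 2 * ρ ^ g * ∫ x, |G x| ∂P) * ρ ^ k) :=
        sum_sum_max (fun k => (4 * (2 * C) ^ 2 * ρ ^ g * ∫ x, |G x| ∂P) * ρ ^ k) b
    _ = (4 * (2 * C) ^ 2 * ρ ^ g * ∫ x, |G x| ∂P) * ∑ k ∈ Finset.range b, (2 * (k : ℝ) + 1) * ρ ^ k := by
        rw [Finset.mul_sum]
        exact Finset.sum_congr rfl fun k _ => by ring
    _ ≤ (4 * (2 * C) ^ 2 * ρ ^ g * ∫ x, |G x| ∂P) * ((1 + ρ) / (1 - ρ) ^ 2) :=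
        mul_le_mul_of_nonneg_left (sum_range_odd_mul_pow_le hl0 hρ1 b) (by positivity)
    _ = 4 * (2 * C) ^ 2 * ((1 + ρ) / (1 - ρ) ^ 2) * ρ ^ g * ∫ x, |G x| ∂P := by ring

end Decorrelation

end Summit.Ventures.LatticeQCDFlow.Scoring

end
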